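import Summits.ResolutionOfSingularities.ResolutionOfSingularities.Theses.RadicialJung
import Summits.ResolutionOfSingularities.ResolutionOfSingularities.Theorems.RadicialJungCleanModelsReduction
import Summits.ResolutionOfSingularities.ResolutionOfSingularities.Theorems.RadicialJungCleanModelsGenerisation
import Literature.AlgebraicGeometry.Motives.RatFnBirational
import Literature.AlgebraicGeometry.Resolution.StalkSpecializesLocalization
import HarnessLib

/-!
# Route `RadicialJung`, crux `CleanModels`: loose cleanness at CLOSED points suffices

Route `ResolutionOfSingularities/RadicialJung`, crux item `CleanModels`
(stmt-ResolutionOfSingularities-15917), line `Sketch`, lead prover, 2026-08-17 (rev 2/3 of the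
skeleton `Cruxes/CleanModels/Lines/Sketch.lean`).

`CleanModels` = LOG-CLEAN MODELS EXIST: for `p` prime, `k` any field of characteristic `p`, `W`
regular integral separated of finite type over `k` and `L/K(W)` purely inseparable of degree `p`,
some proper birational REGULAR `π : V → W` carries at every point `v` an element `y ∈ L ∖ K(W)`,
`y^p = g`, with `π^*g` EXACTLY clean at `v` (toroidal type `∏_{i<m} t_i^{a_i}`, or regular type).

This file removes one of the route's recorded risks for the crux ("algebraic `t_i` may … fail at
non-closed points"): **it suffices to produce a proper birational regular model which is LOOSELY
clean at every CLOSED point** (`cleanModels_of_looseCleanModelsClosedPoints`; loose = unit factors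
allowed in the toroidal form, type (ii) read as `c^p +` regular parameter). The content is the
GENERISATION of loose cleanness from a regular local ring `O = 𝒪_{V,v}` of characteristic `p` to
its localisation `O_q = 𝒪_{V,v'}` at the prime of a generisation `v' ⤳ v` (`stub_looseGenerises`,
file `RadicialJungCleanModelsGenerisation.lean`, assembled from the landed stubs of the line):

* regular type (i) (a unit `u`, residually not a `p`-th power): a derivation `D` of the completion
  `Ô` with `D(u)` a unit (`stub_completionDerivationUnit`: Cohen structure theorem + weak `p`-basis
  theorem) does not vanish at a prime `Q` of `Ô` over `q` (`stub_completionLift`: faithful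
  flatness), so by the Leibniz obstruction (`stub_leibnizObstruction`, Stacks 07PF) `u` is of loose
  regular type at `O_q` (`regularType_generises`);
* regular type (ii) (`t₀ = s - c^p ∈ 𝔪 ∖ 𝔪²`): complete `t₀` to a regular system of parameters
  (`stub_extendParameter`); if `t₀ ∈ q` it is a boundary parameter of a loosely toroidal form at `q`
  (`stub_parameterGenerises`), otherwise `∂/∂t₀` on `Ô` (`stub_completionDerivationParam`) has
  `D(t₀) = 1 ∉ Q`;
* toroidal type `u ∏ t_i^{a_i}`: if some boundary parameter lies in `q`, the form stays loosely
  toroidal at `q` (`stub_parameterGenerises`, Serre); if none does, the twisted representative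
  `e^p x^α = u^α t_0 ∏_{i>0} t_i^{r_i}` (`α a_0 ≡ 1 mod p`) has `∂/∂t_0`-derivative outside every
  prime over `q` (`stub_toroidalTwist`), hence is of loose regular type at `q`.

Scheme-theoretically (`looseCleanAll_of_closedPoints`): every point of the quasi-compact `V`
specialises to a closed point (`IsClosed.exists_closed_singleton`), the stalk at the generisation
is a localisation of the closed stalk (`isLocalizationAtPrime_stalkSpecializes`, Stacks 01J7), and
the admissible modification `y ↦ e y^α - c` keeps `y ∉ K(W)` (`not_mem_range_twist`). Finally the
rev-1 transfer (`cleanModels_of_looseCleanAll`, from the landed `stub_pointwiseTransfer`)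
normalises loose forms to the crux's exact ones.
-/

noncomputable section

set_option linter.dupNamespace false -- mandated namespace of this single-conjunct summit

open CategoryTheory AlgebraicGeometry TopologicalSpace IsLocalRing
open Literature.AlgebraicGeometry.Resolution Literature.AlgebraicGeometry.Motives

namespace Summit.ResolutionOfSingularities.ResolutionOfSingularities.Theorems.RadicialJung.CleanModels

universe u

/-! ## From closed points to all points, and to the crux -/

/-- **Admissible modifications stay outside the base field.** If `y ∈ L ∖ K` with `y^p ∈ K`
(`char = p` prime), `p ∤ α` and `e ∈ K ∖ {0}`, then `e y^α - c ∉ K` for every `c ∈ K`. [folklore] -/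
theorem not_mem_range_twist {K L : Type*} [Field K] [Field L] [Algebra K L] (p : ℕ)
    (y : L) (hy : y ∉ Set.range (algebraMap K L))
    (hyp : ∃ x : K, algebraMap K L x = y ^ p) (α : ℕ) (hα : α.Coprime p) (e c : K)
    (he : e ≠ 0) : algebraMap K L e * y ^ α - algebraMap K L c ∉ Set.range (algebraMap K L) := by
  rintro ⟨z, hz⟩
  -- `y^α ∈ K`
  have hα' : y ^ α ∈ Set.range (algebraMap K L) := by
    refine ⟨(z + c) / e, ?_⟩
    rw [map_div₀, map_add, hz, sub_add_cancel, mul_div_cancel_left₀ _ ((map_ne_zero _).mpr he)]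
  -- Bézout: `1 = a α + b p` in `ℤ`, so `y = (y^α)^a (y^p)^b ∈ K`
  obtain ⟨x, hx⟩ := hyp
  obtain ⟨w, hw⟩ := hα'
  have hy0 : y ≠ 0 := by
    rintro rfl
    exact hy ⟨0, by simp⟩
  obtain ⟨a, b, hab⟩ := Nat.isCoprime_iff_coprime.mpr hα
  apply hy
  refine ⟨w ^ a * x ^ b, ?_⟩
  rw [map_mul, map_zpow₀, map_zpow₀, hw, hx, ← zpow_natCast, ← zpow_natCast, ← zpow_mul,
    ← zpow_mul, ← zpow_add₀ hy0]
  have : ((α : ℕ) : ℤ) * a + ((p : ℕ) : ℤ) * b = 1 := by linarith [hab]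
  rw [this, zpow_one]

/-- **Loose cleanness at closed points gives loose cleanness everywhere** on a regular integral
scheme of finite type over a field: every point `v'` specialises to a closed point `v`
(`IsClosed.exists_closed_singleton`), `𝒪_{V,v'}` is a localisation of `𝒪_{V,v}`
(`isLocalizationAtPrime_stalkSpecializes`), and loose cleanness generises along it
(`stub_looseGenerises`), at the cost of replacing `y` by an admissible `e y^α - c ∉ K(W)`. -/
theorem looseCleanAll_of_closedPoints (p : ℕ) (hp : p.Prime) (k : Type) [Field k] [CharP k p]
    (W : Scheme.{0}) [IsIntegral W] (f : W ⟶ Spec (.of k)) [QuasiCompact f] (L : Type) [Field L]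
    [Algebra W.functionField L]
    (V : Scheme.{0}) (π : V ⟶ W) [IsIntegral V] [IsDominant π] [IsProper π]
    (hπbir : IsBirational π) (hVreg : Scheme.IsRegular V)
    (hclosed : ∀ v : V, IsClosed ({v} : Set V) → ∃ (y : L) (g : W.functionField),
        y ∉ Set.range (algebraMap W.functionField L) ∧ algebraMap W.functionField L g = y ^ p ∧
        ((∃ (d m : ℕ) (hmd : m ≤ d) (t : Fin d → V.presheaf.stalk v) (a : Fin m → ℕ)
            (u : V.presheaf.stalk v), IsUnit u ∧
            Ideal.span (Set.range t) = maximalIdeal (V.presheaf.stalk v) ∧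
            ringKrullDim (V.presheaf.stalk v) = (d : WithBot ℕ∞) ∧ 0 < m ∧ (∀ i, ¬ p ∣ a i) ∧
            RatFn.functionFieldMap π g = algebraMap (V.presheaf.stalk v) V.functionField
              (u * ∏ i : Fin m, t (Fin.castLE hmd i) ^ (a i))) ∨
          (∃ u : V.presheaf.stalk v, IsUnit u ∧
            RatFn.functionFieldMap π g = algebraMap (V.presheaf.stalk v) V.functionField u ∧
            ∀ c : V.presheaf.stalk v, u - c ^ p ∉ maximalIdeal (V.presheaf.stalk v)) ∨
          (∃ s c : V.presheaf.stalk v,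
            RatFn.functionFieldMap π g = algebraMap (V.presheaf.stalk v) V.functionField s ∧
            s - c ^ p ∈ maximalIdeal (V.presheaf.stalk v) ∧
            s - c ^ p ∉ maximalIdeal (V.presheaf.stalk v) ^ 2))) (v' : V) :
    ∃ (y : L) (g : W.functionField),
        y ∉ Set.range (algebraMap W.functionField L) ∧ algebraMap W.functionField L g = y ^ p ∧
        ((∃ (d m : ℕ) (hmd : m ≤ d) (t : Fin d → V.presheaf.stalk v') (a : Fin m → ℕ)
            (u : V.presheaf.stalk v'), IsUnit u ∧
            Ideal.span (Set.range t) = maximalIdeal (V.presheaf.stalk v') ∧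
            ringKrullDim (V.presheaf.stalk v') = (d : WithBot ℕ∞) ∧ 0 < m ∧ (∀ i, ¬ p ∣ a i) ∧
            RatFn.functionFieldMap π g = algebraMap (V.presheaf.stalk v') V.functionField
              (u * ∏ i : Fin m, t (Fin.castLE hmd i) ^ (a i))) ∨
          (∃ u : V.presheaf.stalk v', IsUnit u ∧
            RatFn.functionFieldMap π g = algebraMap (V.presheaf.stalk v') V.functionField u ∧
            ∀ c : V.presheaf.stalk v', u - c ^ p ∉ maximalIdeal (V.presheaf.stalk v')) ∨
          (∃ s c : V.presheaf.stalk v',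
            RatFn.functionFieldMap π g = algebraMap (V.presheaf.stalk v') V.functionField s ∧
            s - c ^ p ∈ maximalIdeal (V.presheaf.stalk v') ∧
            s - c ^ p ∉ maximalIdeal (V.presheaf.stalk v') ^ 2)) := by
  haveI : Fact p.Prime := ⟨hp⟩
  -- `V` is quasi-compact, so `v'` specialises to a closed point `v`
  haveI : CompactSpace V := QuasiCompact.compactSpace_of_compactSpace (π ≫ f)
  obtain ⟨v, hv, hvcl⟩ := (isClosed_closure (s := ({v'} : Set V))).exists_closed_singleton
    ⟨v', subset_closure rfl⟩
  have hsp : v' ⤳ v := specializes_iff_mem_closure.mpr hv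
  obtain ⟨y, g, hy, hyg, hloose⟩ := hclosed v hvcl
  -- the stalk at `v'` is a localisation of the stalk at `v`, compatibly with `K(V)`
  letI alg := (V.presheaf.stalkSpecializes hsp).hom.toAlgebra
  set q := (maximalIdeal (V.presheaf.stalk v')).comap (V.presheaf.stalkSpecializes hsp).hom
    with hqdef
  haveI : q.IsPrime := Ideal.comap_isPrime _ _
  haveI : IsLocalization.AtPrime (V.presheaf.stalk v') q :=
    isLocalizationAtPrime_stalkSpecializes hsp
  haveI : IsScalarTower (V.presheaf.stalk v) (V.presheaf.stalk v') V.functionField := by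
    refine IsScalarTower.of_algebraMap_eq' ?_
    change _ = (V.presheaf.stalkSpecializes _).hom.comp (V.presheaf.stalkSpecializes hsp).hom
    rw [← CommRingCat.hom_comp, TopCat.Presheaf.stalkSpecializes_comp]
    rfl
  haveI : CharP (V.presheaf.stalk v) p := charP_stalk V (π ≫ f) v
  haveI : IsRegularLocalRing (V.presheaf.stalk v) := hVreg v
  -- generise
  obtain ⟨α, e, c, hα, he, hloose'⟩ := stub_looseGenerises (O := V.presheaf.stalk v) p
    (K := V.functionField) q (V.presheaf.stalk v') (RatFn.functionFieldMap π g) hloose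
  -- read `e`, `c` in `K(W)` along `π^♯ : K(W) ≅ K(V)`
  have hbij : Function.Bijective (RatFn.functionFieldMap π) := by
    obtain ⟨U, hU, hU', hiso⟩ := hπbir
    haveI := hiso
    exact RatFn.functionFieldMap_bijective_of_isIso_morphismRestrict π U hU hU'
  let eq : W.functionField ≃+* V.functionField := RingEquiv.ofBijective _ hbij
  have heq : ∀ x, eq x = RatFn.functionFieldMap π x := fun _ => rfl
  have he' : eq.symm e ≠ 0 := by
    intro h0
    apply he
    rw [← eq.apply_symm_apply e, h0, map_zero]
  refine ⟨algebraMap W.functionField L (eq.symm e) * y ^ α - algebraMap W.functionField L (eq.symm c),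
    eq.symm e ^ p * g ^ α - eq.symm c ^ p,
    not_mem_range_twist p y hy ⟨g, hyg⟩ α hα _ _ he', ?_, ?_⟩
  · haveI : CharP W.functionField p := charP_stalk W f _
    haveI : CharP L p := charP_of_injective_algebraMap (algebraMap W.functionField L).injective p
    rw [map_sub, map_mul, map_pow, map_pow, map_pow, hyg, sub_pow_char, mul_pow, ← pow_mul,
      ← pow_mul, mul_comm p α]
  · have hmap : RatFn.functionFieldMap π (eq.symm e ^ p * g ^ α - eq.symm c ^ p) =
        e ^ p * RatFn.functionFieldMap π g ^ α - c ^ p := by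
      have h1 : RatFn.functionFieldMap π (eq.symm e) = e := by
        rw [← heq, RingEquiv.apply_symm_apply]
      have h2 : RatFn.functionFieldMap π (eq.symm c) = c := by
        rw [← heq, RingEquiv.apply_symm_apply]
      rw [map_sub, map_mul, map_pow, map_pow, map_pow, h1, h2]
    rw [hmap]
    exact hloose'

/-- **The crux from a model which is loosely clean at every point** (rev-1 transfer): at each
point normalise the loose form by `x ↦ ε^p x + δ` (`stub_pointwiseTransfer`, landed), transport
`ε` to `K(W)` along `π^♯ : K(W) ≅ K(V)` and replace `y` by `ε y + δ`. -/
theorem cleanModels_of_looseCleanAll (p : ℕ) (hp : p.Prime) (k : Type) [Field k] [CharP k p]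
    (W : Scheme.{0}) [IsIntegral W] (f : W ⟶ Spec (.of k)) (L : Type) [Field L]
    [Algebra W.functionField L] (V : Scheme.{0}) (π : V ⟶ W) [IsIntegral V] [IsDominant π]
    (hπbir : IsBirational π)
    (hall : ∀ v : V, ∃ (y : L) (g : W.functionField),
        y ∉ Set.range (algebraMap W.functionField L) ∧ algebraMap W.functionField L g = y ^ p ∧
        ((∃ (d m : ℕ) (hmd : m ≤ d) (t : Fin d → V.presheaf.stalk v) (a : Fin m → ℕ)
            (u : V.presheaf.stalk v), IsUnit u ∧
            Ideal.span (Set.range t) = maximalIdeal (V.presheaf.stalk v) ∧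
            ringKrullDim (V.presheaf.stalk v) = (d : WithBot ℕ∞) ∧ 0 < m ∧ (∀ i, ¬ p ∣ a i) ∧
            RatFn.functionFieldMap π g = algebraMap (V.presheaf.stalk v) V.functionField
              (u * ∏ i : Fin m, t (Fin.castLE hmd i) ^ (a i))) ∨
          (∃ u : V.presheaf.stalk v, IsUnit u ∧
            RatFn.functionFieldMap π g = algebraMap (V.presheaf.stalk v) V.functionField u ∧
            ∀ c : V.presheaf.stalk v, u - c ^ p ∉ maximalIdeal (V.presheaf.stalk v)) ∨
          (∃ s c : V.presheaf.stalk v,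
            RatFn.functionFieldMap π g = algebraMap (V.presheaf.stalk v) V.functionField s ∧
            s - c ^ p ∈ maximalIdeal (V.presheaf.stalk v) ∧
            s - c ^ p ∉ maximalIdeal (V.presheaf.stalk v) ^ 2))) (v : V) :
    ∃ (y : L) (g : W.functionField), y ∉ Set.range (algebraMap W.functionField L) ∧
      algebraMap W.functionField L g = y ^ p ∧
      ((∃ (d m : ℕ) (hmd : m ≤ d) (t : Fin d → V.presheaf.stalk v) (a : Fin m → ℕ),
          Ideal.span (Set.range t) = maximalIdeal (V.presheaf.stalk v) ∧
          ringKrullDim (V.presheaf.stalk v) = (d : WithBot ℕ∞) ∧ 0 < m ∧ (∀ i, ¬ p ∣ a i) ∧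
          RatFn.functionFieldMap π g = ∏ i : Fin m,
            (algebraMap (V.presheaf.stalk v) V.functionField (t (Fin.castLE hmd i))) ^ (a i)) ∨
        (∃ u₀ : V.presheaf.stalk v, IsUnit u₀ ∧
          RatFn.functionFieldMap π g = algebraMap (V.presheaf.stalk v) V.functionField u₀ ∧
          ((∀ c : V.presheaf.stalk v, u₀ - c ^ p ∉ maximalIdeal (V.presheaf.stalk v)) ∨
            (∃ c : V.presheaf.stalk v, u₀ - c ^ p ∈ maximalIdeal (V.presheaf.stalk v) ∧
              u₀ - c ^ p ∉ maximalIdeal (V.presheaf.stalk v) ^ 2)))) := by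
  haveI : Fact p.Prime := ⟨hp⟩
  haveI : CharP (V.presheaf.stalk v) p := charP_stalk V (π ≫ f) v
  haveI : CharP W.functionField p := charP_stalk W f _
  haveI : CharP L p := charP_of_injective_algebraMap (algebraMap W.functionField L).injective p
  obtain ⟨y, g, hy, hyg, hloose⟩ := hall v
  obtain ⟨ε, δ, hε, hδ, hexact⟩ := stub_pointwiseTransfer (O := V.presheaf.stalk v)
    (K := V.functionField) p hp (RatFn.functionFieldMap π g) hloose
  -- `π^♯ : K(W) ≅ K(V)`
  have hbij : Function.Bijective (RatFn.functionFieldMap π) := by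
    obtain ⟨U, hU, hU', hiso⟩ := hπbir
    haveI := hiso
    exact RatFn.functionFieldMap_bijective_of_isIso_morphismRestrict π U hU hU'
  let eq : W.functionField ≃+* V.functionField := RingEquiv.ofBijective _ hbij
  have heq : ∀ x, eq x = RatFn.functionFieldMap π x := fun _ => rfl
  set ε' : W.functionField := eq.symm (algebraMap (V.presheaf.stalk v) V.functionField ε)
    with hε'def
  have heε' : RatFn.functionFieldMap π ε' = algebraMap (V.presheaf.stalk v) V.functionField ε := by
    rw [← heq, hε'def, RingEquiv.apply_symm_apply]
  have hε' : ε' ≠ 0 := by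
    intro h0
    have h1 : algebraMap (V.presheaf.stalk v) V.functionField ε = 0 := by
      rw [← heε', h0, map_zero]
    exact (hε.map (algebraMap (V.presheaf.stalk v) V.functionField)).ne_zero h1
  refine ⟨algebraMap W.functionField L ε' * y + δ, ε' ^ p * g + δ, ?_, ?_, ?_⟩
  · rintro ⟨x, hx⟩
    apply hy
    refine ⟨(x - δ) / ε', ?_⟩
    rw [map_div₀, map_sub, hx, map_natCast, add_sub_cancel_right, mul_div_cancel_left₀]
    exact (map_ne_zero _).mpr hε'
  · rw [map_add, map_mul, map_pow, hyg, map_natCast, add_pow_char, mul_pow]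
    congr 1
    have : ((δ : L)) ^ p = δ := by
      interval_cases δ <;> simp [hp.ne_zero]
    exact this.symm
  · have hmap : RatFn.functionFieldMap π (ε' ^ p * g + δ) =
        algebraMap (V.presheaf.stalk v) V.functionField ε ^ p * RatFn.functionFieldMap π g + δ := by
      rw [map_add, map_mul, map_pow, heε', map_natCast]
    rw [hmap]
    exact hexact

/-- **The crux follows from a loosely log-clean model at closed points.** If for every prime `p`,
every field `k` of characteristic `p`, every regular integral separated `W` of finite type over `k`
and every purely inseparable `L/K(W)` of degree `p` there is a proper birational `π : V → W`, `V`
integral and regular, such that at every CLOSED point `v ∈ V` some `y ∈ L ∖ K(W)`, `y^p = g`, has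
`π^*g` LOOSELY clean (`u ∏_{i<m} t_i^{a_i}` with `u` a unit, `m ≥ 1`, `p ∤ a_i`; or a unit residually
not a `p`-th power; or `c^p +` a regular parameter), then `CleanModels` holds
(`looseCleanAll_of_closedPoints` + `cleanModels_of_looseCleanAll`). -/
theorem cleanModels_of_looseCleanModelsClosedPoints
    (h : ∀ (p : ℕ), p.Prime → ∀ (k : Type) [Field k] [CharP k p] (W : Scheme.{0}) [IsIntegral W]
      (f : W ⟶ Spec (.of k)) [IsSeparated f] [LocallyOfFiniteType f] [QuasiCompact f],
      Scheme.IsRegular W → ∀ (L : Type) [Field L] [Algebra W.functionField L]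
      [IsPurelyInseparable W.functionField L], Module.finrank W.functionField L = p →
      ∃ (V : Scheme.{0}) (π : V ⟶ W) (_ : IsIntegral V) (_ : IsDominant π),
        IsProper π ∧ IsBirational π ∧ Scheme.IsRegular V ∧
        ∀ v : V, IsClosed ({v} : Set V) → ∃ (y : L) (g : W.functionField),
          y ∉ Set.range (algebraMap W.functionField L) ∧ algebraMap W.functionField L g = y ^ p ∧
          ((∃ (d m : ℕ) (hmd : m ≤ d) (t : Fin d → V.presheaf.stalk v) (a : Fin m → ℕ)
              (u : V.presheaf.stalk v), IsUnit u ∧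
              Ideal.span (Set.range t) = maximalIdeal (V.presheaf.stalk v) ∧
              ringKrullDim (V.presheaf.stalk v) = (d : WithBot ℕ∞) ∧ 0 < m ∧ (∀ i, ¬ p ∣ a i) ∧
              RatFn.functionFieldMap π g = algebraMap (V.presheaf.stalk v) V.functionField
                (u * ∏ i : Fin m, t (Fin.castLE hmd i) ^ (a i))) ∨
            (∃ u : V.presheaf.stalk v, IsUnit u ∧
              RatFn.functionFieldMap π g = algebraMap (V.presheaf.stalk v) V.functionField u ∧
              ∀ c : V.presheaf.stalk v, u - c ^ p ∉ maximalIdeal (V.presheaf.stalk v)) ∨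
            (∃ s c : V.presheaf.stalk v,
              RatFn.functionFieldMap π g = algebraMap (V.presheaf.stalk v) V.functionField s ∧
              s - c ^ p ∈ maximalIdeal (V.presheaf.stalk v) ∧
              s - c ^ p ∉ maximalIdeal (V.presheaf.stalk v) ^ 2))) :
    Summit.ResolutionOfSingularities.ResolutionOfSingularities.Theses.RadicialJung.CleanModels := by
  intro p hp k _ _ W _ f L _ _ hsep hloc hqc hWreg hPI hdeg
  haveI := hsep; haveI := hloc; haveI := hqc; haveI := hPI
  obtain ⟨V, π, hVint, hπdom, hπprop, hπbir, hVreg, hclosed⟩ := h p hp k W f hWreg L hdeg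
  haveI := hπprop
  refine ⟨V, π, hVint, hπdom, hπprop, hπbir, hVreg, fun v => ?_⟩
  exact cleanModels_of_looseCleanAll p hp k W f L V π hπbir
    (looseCleanAll_of_closedPoints p hp k W f L V π hπbir hVreg hclosed) v

/-- **Exactness of the cut.** Conversely `CleanModels` gives, trivially, a model which is loosely
clean at closed points (exact forms are loose forms with unit factor `1`), so the open stub of the
line is EQUIVALENT to the crux. -/
theorem cleanModels_iff_looseCleanModelsClosedPoints :
    Summit.ResolutionOfSingularities.ResolutionOfSingularities.Theses.RadicialJung.CleanModels ↔
    (∀ (p : ℕ), p.Prime → ∀ (k : Type) [Field k] [CharP k p] (W : Scheme.{0}) [IsIntegral W]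
      (f : W ⟶ Spec (.of k)) [IsSeparated f] [LocallyOfFiniteType f] [QuasiCompact f],
      Scheme.IsRegular W → ∀ (L : Type) [Field L] [Algebra W.functionField L]
      [IsPurelyInseparable W.functionField L], Module.finrank W.functionField L = p →
      ∃ (V : Scheme.{0}) (π : V ⟶ W) (_ : IsIntegral V) (_ : IsDominant π),
        IsProper π ∧ IsBirational π ∧ Scheme.IsRegular V ∧
        ∀ v : V, IsClosed ({v} : Set V) → ∃ (y : L) (g : W.functionField),
          y ∉ Set.range (algebraMap W.functionField L) ∧ algebraMap W.functionField L g = y ^ p ∧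
          ((∃ (d m : ℕ) (hmd : m ≤ d) (t : Fin d → V.presheaf.stalk v) (a : Fin m → ℕ)
              (u : V.presheaf.stalk v), IsUnit u ∧
              Ideal.span (Set.range t) = maximalIdeal (V.presheaf.stalk v) ∧
              ringKrullDim (V.presheaf.stalk v) = (d : WithBot ℕ∞) ∧ 0 < m ∧ (∀ i, ¬ p ∣ a i) ∧
              RatFn.functionFieldMap π g = algebraMap (V.presheaf.stalk v) V.functionField
                (u * ∏ i : Fin m, t (Fin.castLE hmd i) ^ (a i))) ∨
            (∃ u : V.presheaf.stalk v, IsUnit u ∧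
              RatFn.functionFieldMap π g = algebraMap (V.presheaf.stalk v) V.functionField u ∧
              ∀ c : V.presheaf.stalk v, u - c ^ p ∉ maximalIdeal (V.presheaf.stalk v)) ∨
            (∃ s c : V.presheaf.stalk v,
              RatFn.functionFieldMap π g = algebraMap (V.presheaf.stalk v) V.functionField s ∧
              s - c ^ p ∈ maximalIdeal (V.presheaf.stalk v) ∧
              s - c ^ p ∉ maximalIdeal (V.presheaf.stalk v) ^ 2))) := by
  refine ⟨fun hC => ?_, cleanModels_of_looseCleanModelsClosedPoints⟩
  intro p hp k _ _ W _ f _ _ _ hWreg L _ _ _ hdeg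
  obtain ⟨V, π, hVint, hπdom, hπprop, hπbir, hVreg, hall⟩ :=
    hC p hp k W f L inferInstance inferInstance inferInstance hWreg inferInstance hdeg
  refine ⟨V, π, hVint, hπdom, hπprop, hπbir, hVreg, fun v _ => ?_⟩
  obtain ⟨y, g, hy, hyg, hexact⟩ := hall v
  refine ⟨y, g, hy, hyg, ?_⟩
  rcases hexact with ⟨d, m, hmd, t, a, ht, hd, hm, ha, hg⟩ | ⟨u₀, hu₀, hg, hcase⟩
  · refine Or.inl ⟨d, m, hmd, t, a, 1, isUnit_one, ht, hd, hm, ha, ?_⟩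
    rw [hg, one_mul, map_prod]
    simp only [map_pow]
  · rcases hcase with hno | ⟨c, hc₁, hc₂⟩
    · exact Or.inr (Or.inl ⟨u₀, hu₀, hg, hno⟩)
    · exact Or.inr (Or.inr ⟨u₀, c, hg, hc₁, hc₂⟩)

end Summit.ResolutionOfSingularities.ResolutionOfSingularities.Theorems.RadicialJung.CleanModels

end
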